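import Literature.Analysis.FluidPDE.CorrectorFourierSolution
import Literature.Analysis.FluidPDE.NavierStokesCorrectorAntidivergenceBound
import HarnessLib

/-!
# Cheskidov–Luo (2022), §3.1: the local existence fact and the corrector fact, discharged

Analysis/FluidPDE proof file: the assembly of the discharge of
`Literature.Analysis.FluidPDE.Torus.CheskidovLuo2022Corrector` (the named fact of
`NavierStokesConcentrationCorrector`, Cheskidov–Luo 2022, §3.1 (3.2)–(3.3) and Prop. 3.2).

* `Torus.CheskidovLuo2022LocalExistence_holds` — the **local wellposedness fact**
  `Torus.CheskidovLuo2022LocalExistence` (CL22 §3.1, p. 14: "Since the initial data for `vᵢ` is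
  zero and `u` and `R` are smooth on `[0,1] × 𝕋^d`, thanks to the general local wellposedness
  theory of the Navier-Stoke equations (or the Euler equations in the inviscid case), for all
  sufficiently small `τ > 0`, we may solve equation (3.2) on intervals `t ∈ [tᵢ, tᵢ₊₁]` to obtain
  a unique smooth solution `vᵢ`", with the smallness `|vᵢ| ≤ δ` of Prop. 3.2) is PROVED: the
  background on `[0, T]` has Fourier coefficients of order `2#d + 1` bounded by global constants
  `A`, `B` (`ScalarFourier.exists_hasDecay_mFourierCoeff_spaceTime`); with the radius
  `ρ = δ / (#d · latMass + 1)` the threshold `θ₀(ρ, A, B)` of `CorrectorFourier.exists_threshold`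
  gives `n₀ = ⌈T/θ₀⌉ + 1`; on each `[tᵢ, tᵢ + T/n]`, `n ≥ n₀`, the time-translated background is
  fed to the Fourier–Picard construction `CorrectorFourier.isLinearizedNSSolutionOn_vel`
  (`CorrectorFourierDefs` … `CorrectorFourierSolution`) and the solution is translated back
  (`Torus.timeDerivWithin_comp_add_const`);
* `Torus.CheskidovLuo2022Corrector_holds` — the corrector fact itself, by
  `CheskidovLuo2022Corrector.of_localExistence` (`NavierStokesCorrectorAntidivergenceBound`:
  the antidivergence bound of Prop. 3.2 with `p = 1`, discharged by the heat-flow antidivergence).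

## References

* A. Cheskidov, X. Luo, *Sharp nonuniqueness for the Navier–Stokes equations*, Invent. Math.
  229 (2022), §3.1 (3.2)–(3.3), Proposition 3.2; arXiv:2009.06596, pp. 14–15. [`CheskidovLuo2022`]
-/

noncomputable section

open MeasureTheory Real Set Filter Topology UnitAddTorus

namespace Literature.Analysis.FluidPDE

namespace Torus

open CorrectorFourier ScalarFourier
open FourierNS (HasDecay)
open Literature.Analysis.FunctionSpaces.Torus (IsSmooth)

variable {d : Type*} [Fintype d] [DecidableEq d]

/-! ### Time translation of the local structure -/

omit [Fintype d] [DecidableEq d] in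
/-- `(· - a)` maps `[a, a + θ]` into `[0, θ]`. [folklore] -/
private theorem sub_mem_Icc_of_mem {θ a t : ℝ} (ht : t ∈ Icc a (a + θ)) : t - a ∈ Icc 0 θ :=
  ⟨by linarith [ht.1], by linarith [ht.2]⟩

omit [DecidableEq d] in
/-- Time translation of joint smoothness from `[0, θ]` to `[a, a + θ]`. [folklore] -/
theorem _root_.Literature.Analysis.FunctionSpaces.Torus.IsSmoothSpaceTimeOn.comp_sub_const_Icc {F : Type*}
    [NormedAddCommGroup F] [NormedSpace ℝ F] {θ a : ℝ} {w : ℝ → UnitAddTorus d → F}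
    (h : FunctionSpaces.Torus.IsSmoothSpaceTimeOn (Icc 0 θ) w) :
    FunctionSpaces.Torus.IsSmoothSpaceTimeOn (Icc a (a + θ)) (fun t => w (t - a)) := by
  have h1 := h.comp_add_const (-a)
  rw [Torus.preimage_add_const_Icc'] at h1
  simp only [sub_neg_eq_add, zero_add, ← sub_eq_add_neg] at h1
  rw [add_comm θ a] at h1
  exact h1

omit [Fintype d] [DecidableEq d] in
/-- Time translation of the one-sided time derivative from `[0, θ]` to `[a, a + θ]`. [folklore] -/
theorem timeDerivWithin_comp_sub_const_Icc {F : Type*} [NormedAddCommGroup F] [NormedSpace ℝ F]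
    (θ a : ℝ) (w : ℝ → UnitAddTorus d → F) (t : ℝ) (x : UnitAddTorus d) :
    FunctionSpaces.Torus.timeDerivWithin (Icc a (a + θ)) (fun s => w (s - a)) t x =
      FunctionSpaces.Torus.timeDerivWithin (Icc 0 θ) w (t - a) x := by
  have h := Torus.timeDerivWithin_comp_add_const (Icc 0 θ) w (-a) t x
  rw [Torus.preimage_add_const_Icc'] at h
  simp only [sub_neg_eq_add, zero_add, ← sub_eq_add_neg] at h
  rw [add_comm θ a] at h
  exact h

/-- **Time translation of a local solution of (3.2).** A solution on `[0, θ]` against the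
translated background `u(· + a)`, `R(· + a)` translates to a solution on `[a, a + θ]` against
`u`, `R`. [folklore] -/
theorem IsLinearizedNSSolutionOn.translate {θ a : ℝ} {u : ℝ → UnitAddTorus d → EuclideanSpace ℝ d}
    {R : ℝ → UnitAddTorus d → d → EuclideanSpace ℝ d} {v : ℝ → UnitAddTorus d → EuclideanSpace ℝ d}
    {q : ℝ → UnitAddTorus d → ℝ}
    (h : IsLinearizedNSSolutionOn (fun s => u (s + a)) (fun s => R (s + a)) 0 θ v q) :
    IsLinearizedNSSolutionOn u R a (a + θ) (fun t => v (t - a)) (fun t => q (t - a)) where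
  smooth_v := h.smooth_v.comp_sub_const_Icc
  smooth_q := h.smooth_q.comp_sub_const_Icc
  momentum t ht x := by
    have hm := h.momentum (t - a) (sub_mem_Icc_of_mem ht) x
    simp only [sub_add_cancel] at hm
    rw [timeDerivWithin_comp_sub_const_Icc]
    exact hm
  divFree t ht := h.divFree (t - a) (sub_mem_Icc_of_mem ht)
  initial x := by simp only [sub_self]; exact h.initial x
  hasZeroMean_v t ht := h.hasZeroMean_v (t - a) (sub_mem_Icc_of_mem ht)
  hasZeroMean_q t ht := h.hasZeroMean_q (t - a) (sub_mem_Icc_of_mem ht)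

/-! ### The local existence fact -/

/-- **Cheskidov–Luo 2022, §3.1: local wellposedness of (3.2) with small solutions, PROVED.**
`Torus.CheskidovLuo2022LocalExistence` holds: for a smooth solution `(u, P, R)` of the
Navier–Stokes–Reynolds system on `[0, T] × 𝕋^d` (`d ≥ 2`) and `δ > 0` there is `n₀` such that
for `n ≥ n₀` and `i < n` the linearised stress-forced system (3.2) has a smooth solution on
`[iT/n, (i+1)T/n]` with zero datum, zero means and `|vᵢ| ≤ δ` (CL22, p. 14: "thanks to the
general local wellposedness theory of the Navier-Stoke equations …, for all sufficiently small
`τ > 0`, we may solve equation (3.2) on intervals `t ∈ [tᵢ, tᵢ₊₁]` to obtain a unique smooth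
solution `vᵢ`"; smallness as in Prop. 3.2). Proof: Picard iteration for the mild formulation on
the Fourier side, in weighted sup-norms on the lattice (`CorrectorFourierDefs` …
`CorrectorFourierSolution`), with a threshold uniform in `i` (global coefficient bounds of the
background on `[0, T]`), and time translation.
[cite: CheskidovLuo2022, §3.1 (3.2) and Prop. 3.2] -/
theorem CheskidovLuo2022LocalExistence_holds : CheskidovLuo2022LocalExistence (d := d) := by
  intro _hd T hT u P R hNSR δ hδ
  have hu : FunctionSpaces.Torus.IsSmoothSpaceTimeOn (Icc 0 T) u := hNSR.smooth_velocity
  have hR : FunctionSpaces.Torus.IsSmoothSpaceTimeOn (Icc 0 T) R := hNSR.smooth_stress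
  have hdiv : ∀ t ∈ Icc 0 T, FunctionSpaces.Torus.IsDivFree (u t) := hNSR.divFree
  -- global coefficient bounds of the background at order `2#d + 1`
  have hAj : ∀ j : d, ∃ C : ℝ, 0 ≤ C ∧ ∀ t ∈ Icc 0 T,
      HasDecay (latOrder d + 1) C (fun k => mFourierCoeff (compC u j t) k) := fun j =>
    exists_hasDecay_mFourierCoeff_spaceTime hT (isSmoothSpaceTimeOn_compC hu j) _
  choose Aj hAj0 hAj using hAj
  have hBq : ∀ q : d × d, ∃ C : ℝ, 0 ≤ C ∧ ∀ t ∈ Icc 0 T,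
      HasDecay (latOrder d + 1) C (fun k => mFourierCoeff (entryC R q.1 q.2 t) k) := fun q =>
    exists_hasDecay_mFourierCoeff_spaceTime hT (isSmoothSpaceTimeOn_entryC hR q.1 q.2) _
  choose Bq hBq0 hBq using hBq
  set A : ℝ := ∑ j, Aj j with hAdef
  set B : ℝ := ∑ q, Bq q with hBdef
  have hA0 : 0 ≤ A := Finset.sum_nonneg fun j _ => hAj0 j
  have hB0 : 0 ≤ B := Finset.sum_nonneg fun q _ => hBq0 q
  have hAall : ∀ t ∈ Icc 0 T, ∀ j, HasDecay (latOrder d + 1) A (fun k => mFourierCoeff (compC u j t) k) :=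
    fun t ht j => (hAj j t ht).mono (Finset.single_le_sum (fun i _ => hAj0 i) (Finset.mem_univ j))
  have hBall : ∀ t ∈ Icc 0 T, ∀ l j, HasDecay (latOrder d + 1) B (fun k => mFourierCoeff (entryC R l j t) k) :=
    fun t ht l j => (hBq (l, j) t ht).mono (Finset.single_le_sum (fun q _ => hBq0 q) (Finset.mem_univ (l, j)))
  -- the radius and the threshold
  have hden : 0 < (Fintype.card d : ℝ) * latMass d + 1 := by
    have := latMass_nonneg (d := d); positivity
  set ρ : ℝ := δ / (Fintype.card d * latMass d + 1) with hρdef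
  have hρ0 : 0 < ρ := div_pos hδ hden
  have hρδ : Fintype.card d * (ρ * latMass d) ≤ δ := by
    have h1 : Fintype.card d * (ρ * latMass d) = ρ * (Fintype.card d * latMass d) := by ring
    have h2 : ρ * (Fintype.card d * latMass d + 1) = δ := by
      rw [hρdef]; field_simp
    nlinarith [hρ0]
  obtain ⟨θ₀, hθ₀, hθ₀1, hthr⟩ := CorrectorFourier.exists_threshold (d := d) hρ0 hA0 hB0
  refine ⟨⌈T / θ₀⌉₊ + 1, Nat.succ_pos _, fun n hn i hi => ?_⟩
  -- the interval length
  have hn0 : (0 : ℝ) < n := by exact_mod_cast lt_of_lt_of_le (Nat.succ_pos _) hn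
  have hθ : 0 < T / n := div_pos hT hn0
  have hθle : T / n ≤ θ₀ := by
    rw [div_le_iff₀ hn0]
    have h1 : T / θ₀ < n := by
      have h2 : (⌈T / θ₀⌉₊ : ℝ) + 1 ≤ n := by exact_mod_cast hn
      linarith [Nat.le_ceil (T / θ₀)]
    have h3 : T = T / θ₀ * θ₀ := by field_simp
    rw [h3]
    nlinarith
  have hθ1 : T / n ≤ 1 := hθle.trans hθ₀1
  obtain ⟨hS1, hS2⟩ := hthr (T / n) hθ hθle
  set θ : ℝ := T / n with hθdef
  -- the translated background on `[0, θ]`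
  set a : ℝ := (i : ℝ) * θ with hadef
  have hi0 : (0 : ℝ) ≤ i := by exact_mod_cast Nat.zero_le i
  have hi1 : (i : ℝ) + 1 ≤ n := by exact_mod_cast Nat.succ_le_of_lt hi
  have ha0 : 0 ≤ a := mul_nonneg hi0 hθ.le
  have haT : a + θ ≤ T := by
    have h1 : a + θ = ((i : ℝ) + 1) * θ := by ring
    have h2 : (n : ℝ) * θ = T := by rw [hθdef]; field_simp
    rw [h1, ← h2]
    exact mul_le_mul_of_nonneg_right hi1 hθ.le
  have hsub : Icc a (a + θ) ⊆ Icc 0 T := Icc_subset_Icc ha0 haT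
  have hmem : ∀ s ∈ Icc 0 θ, s + a ∈ Icc 0 T := fun s hs =>
    hsub ⟨by linarith [hs.1], by linarith [hs.2]⟩
  have hpre : (· + a) ⁻¹' Icc a (a + θ) = Icc 0 θ := by
    rw [Torus.preimage_add_const_Icc', sub_self, add_sub_cancel_left]
  set uτ : ℝ → UnitAddTorus d → EuclideanSpace ℝ d := fun s => u (s + a) with huτdef
  set Rτ : ℝ → UnitAddTorus d → d → EuclideanSpace ℝ d := fun s => R (s + a) with hRτdef
  have huτ : FunctionSpaces.Torus.IsSmoothSpaceTimeOn (Icc 0 θ) uτ := by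
    have h1 := (hu.mono hsub).comp_add_const a
    rwa [hpre] at h1
  have hRτ : FunctionSpaces.Torus.IsSmoothSpaceTimeOn (Icc 0 θ) Rτ := by
    have h1 := (hR.mono hsub).comp_add_const a
    rwa [hpre] at h1
  have hdivτ : ∀ s ∈ Icc 0 θ, FunctionSpaces.Torus.IsDivFree (uτ s) := fun s hs => hdiv (s + a) (hmem s hs)
  have hUA : ∀ j t, HasDecay (latOrder d + 1) A (driftCoeff θ uτ j t) :=
    hasDecay_driftCoeff_of_forall hθ.le fun s hs j => hAall (s + a) (hmem s hs) j
  have hRB : ∀ l j t, HasDecay (latOrder d + 1) B (stressCoeff θ Rτ l j t) :=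
    hasDecay_stressCoeff_of_forall hθ.le fun s hs l j => hBall (s + a) (hmem s hs) l j
  -- the local solution and its translation
  obtain ⟨hsol, hbound⟩ :=
    CorrectorFourier.isLinearizedNSSolutionOn_vel hθ hθ1 huτ hdivτ hRτ hρ0.le hA0 hB0 hUA hRB hS1 hS2
  have hb : ((i : ℝ) + 1) * θ = a + θ := by ring
  refine ⟨fun t => vel θ uτ Rτ (t - a), fun t => pres θ uτ Rτ (t - a), ?_, fun t ht x => ?_⟩
  · rw [hb]
    exact hsol.translate
  · rw [hb] at ht
    exact (hbound (t - a) (sub_mem_Icc_of_mem ht) x).trans hρδ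

/-! ### The corrector fact -/

/-- **Cheskidov–Luo 2022, §3.1 (3.2)–(3.3) and Proposition 3.2 (with `p = 1`), PROVED**:
`Torus.CheskidovLuo2022Corrector` holds — local existence (`CheskidovLuo2022LocalExistence_holds`)
and the antidivergence bound (`CheskidovLuo2022AntidivergenceBound_holds`), assembled by
`CheskidovLuo2022Corrector.of_localExistence`. [cite: CheskidovLuo2022, §3.1 (3.2)–(3.3), Prop. 3.2] -/
theorem CheskidovLuo2022Corrector_holds : CheskidovLuo2022Corrector (d := d) :=
  CheskidovLuo2022Corrector.of_localExistence CheskidovLuo2022LocalExistence_holds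

end Torus

end Literature.Analysis.FluidPDE

end
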